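import Literature.Combinatorics.Optimization.BlockPsdFactorization
import HarnessLib
import HarnessLib.Audit

/-!
# Typed cell target T-SOC (rung leaf F-N2.SOC, D-0061): `(S²₊)^m`-lifts (= second-order-cone lifts) of the
# perfect matching polytope have size `2^{Ω(n)}` — cell pnp-psdrank (D-0047), typed by pnp-psdrank-p2 (g6)

This file ASSERTS NOTHING: it states two closed `Prop`s tagged `@[conjecture]` (= obligation nodes of our
theories, NOT published theorems) with unfolding `example`s, over the TREE vocabulary
`Literature.Combinatorics.Optimization.HasBlockPsdFactorization n b m`
(`Literature/Combinatorics/Optimization/BlockPsdFactorization.lean`: a psd factorization of the odd-cut slack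
matrix `|δ(U) ∩ M| − 1` of Edmonds' perfect matching polytope `P_PM(n)` with `m` blocks of size `b`;
equivalently an `(S^b_+)^m`-lift of `P_PM(n)` by the Gouveia–Parrilo–Thomas cone-factorization theorem
[cite: GouveiaParriloThomas2013, Def. 2.2, Thm. 2.4 (§2)]; `b = 1` is a nonnegative factorization of size `m`;
`b = 2` is a second-order-cone lift, since `S²₊ ≅ L³₊` linearly and "if a convex set has a `(L³₊)^m`-lift …
we say it has a second-order cone lift" [cite: FawziEtAl2020, §1 (arXiv text chunk 5); §5 after Thm. 5.10
("the second order cone `L^{ℓ+1}_+` has a `(S²₊)^ℓ`-lift")]). No local copy of the vocabulary is declared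
here (the bodies below are the cell's `leaf-R4/MatchingSmallBlockPsdBound.lean` token-for-token, with
`HasBlockPsdFactorization` now resolved to the Literature declaration).

RUNG «F-N2.SOC» of the cell's ladder (HOME/pnp-psdrank-p2/ROUND-4.md §6): strictly between Rothvoß's LP
theorem (`b = 1`; tree: `Literature.Barriers.PneNP.pm_bound`, `Literature.Barriers.PneNP.Rothvoss2017_tsp_holds`
[cite: Rothvoss2017, Thm. 1, Cor. 2 (PDF p. 4)]) and the printed-open general question "It remains open whether
matching polytopes also have high semidefinite extension complexity" [cite: FawziEtAl2020, §6 (Discussion),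
¶ "Lower bounds for spectrahedral lifts" (arXiv text chunk 30)]. PRESEARCH (cell memo HOME/pnp-psdrank-lit/LIT-8.md
§2, corpus fts+hybrid ×5, citation graph of arXiv:1311.2571, galaxy --star all): no printed lower bound for
SOC / fixed-block-size psd lifts of the matching polytope was found; nearest print = Fawzi–Parrilo
[cite: FawziParrilo2013, §1.2 (p. 4)] (`(S^d_+)^r`-lifts of the CORRELATION polytope, support-based),
Braun–Pokutta / Sinha (approximate LPs for matching), BBCHPRRWZ (symmetric SDPs [cite: BraunEtAl2016, Thm. 4.10 (p. 10)]).

STATUS (2026-08-26T02:00Z): BOTH statements have kernel-checked proofs in the cell, not yet in the tree —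
`MatchingSmallBlockPsdBound`: pnp-psdrank-eng g3, `HOME/pnp-psdrank-eng/lean/SocLift.lean` v2 (sha16 40f33cea23da6ab6;
v1 68f549726b9fc648), farm rc 0, axioms standard, `α = δ_R/6384` with `δ_R` the tree's Rothvoß constant, referee
audit PASS (pnp-psdrank-ref g13, `HOME/pnp-psdrank-ref/REVIEW-pnp-psdrank-eng-SocLift-g13.md`); `MatchingBlockPsdBound`:
pnp-psdrank-eng g3, `HOME/pnp-psdrank-eng/lean/SocLiftB.lean` (sha16 eae51e26e3e908b8), farm rc 0, axioms standard,
`α_b = δ_R/(798(b+1)(2b+3))` (coordinate-grid net; audit requested). Both are UNCONDITIONAL — the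
Briët–Dadush–Pokutta rescaling of the cell's first plan is replaced by the tree's elementary
`Literature.Combinatorics.Optimization.HasPsdFactorization.rescale_weak`. They are being landed as
`Summits/PneNP/PneNP/Theorems/SmallBlockRothvoss*.lean` (resp. a fixed-`b` sibling); the closers conclude THESE
declarations by name, after which `…_holds` theorems belong in sibling files (this leaf stays a
conjecture-only module, `@[conjecture]` = obligation node of the tree until then). WHAT THIS IS NOT: not a bound
on general psd rank / semidefinite extension complexity of matching (that target is
`Summit.PneNP.MatchingPsdRank.MatchingPsdRankStretchedExp`, still open: the block size is fixed while `n → ∞`);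
nothing here is a claim on P vs NP (matching is in P; this is an unconditional model lower bound in the
Yannakakis programme); the `Ω(n/b)`-for-growing-`b` form predicted in ROUND-4 §6 is NOT one of the statements.
-/

noncomputable section

namespace Summit.PneNP.MatchingPsdRank

open Literature.Combinatorics.Optimization

/-- **T-SOC (`2 × 2`-block psd lifts = second-order-cone lifts of the perfect matching polytope have
exponential size).** There are `α > 0` and `n₀` such that for every even `n ≥ n₀` and every `m`, a psd
factorization of the odd-cut slack matrix of `P_PM(n)` with `m` blocks of size `2`
(`Literature.Combinatorics.Optimization.HasBlockPsdFactorization n 2 m`) forces `2^{α n} ≤ m`. Not in print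
(the general semidefinite question is printed-open); kernel-proved in the cell (see the module docstring), an
obligation node of the tree until its closer lands. WHAT THIS IS NOT: not a bound on the general psd rank /
semidefinite extension complexity of the matching polytope; no claim on P vs NP.
[cite: FawziEtAl2020, §6 (Discussion), ¶ "Lower bounds for spectrahedral lifts" (arXiv text chunk 30)]
[cite: FawziParrilo2013, §1.2 (p. 4)] -/
@[conjecture]
def MatchingSmallBlockPsdBound : Prop :=
  ∃ α : ℝ, 0 < α ∧ ∃ n₀ : ℕ, ∀ n : ℕ, n₀ ≤ n → Even n → ∀ m : ℕ,
    HasBlockPsdFactorization n 2 m → (2 : ℝ) ^ (α * n) ≤ m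

/-- **Fixed block size.** For every `b ≥ 1` there are `α > 0` and `n₀` such that for every even `n ≥ n₀`
and every `m`, an `(S^b_+)^m`-lift of `P_PM(n)` (`HasBlockPsdFactorization n b m`) forces `2^{α n} ≤ m`
(the cell's kernel proof gives `α_b = δ_R/(798(b+1)(2b+3))`; ROUND-4 §6 predicts `Ω(1/b)`). Not in print;
kernel-proved in the cell (see the module docstring), an obligation node of the tree until its closer lands.
WHAT THIS IS NOT: `b` is fixed while `n → ∞` — not a bound on general psd rank; no claim on P vs NP.
[cite: FawziEtAl2020, §6 (Discussion), ¶ "Lower bounds for spectrahedral lifts" (arXiv text chunk 30)]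
[cite: FawziParrilo2013, §1.2 (p. 4)] -/
@[conjecture]
def MatchingBlockPsdBound : Prop :=
  ∀ b : ℕ, 1 ≤ b → ∃ α : ℝ, 0 < α ∧ ∃ n₀ : ℕ, ∀ n : ℕ, n₀ ≤ n → Even n → ∀ m : ℕ,
    HasBlockPsdFactorization n b m → (2 : ℝ) ^ (α * n) ≤ m

/-- Unfolding (the statement is exactly the displayed formula, over the Literature vocabulary). -/
example : MatchingSmallBlockPsdBound ↔
    ∃ α : ℝ, 0 < α ∧ ∃ n₀ : ℕ, ∀ n : ℕ, n₀ ≤ n → Even n → ∀ m : ℕ,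
      Literature.Combinatorics.Optimization.HasBlockPsdFactorization n 2 m → (2 : ℝ) ^ (α * n) ≤ m :=
  Iff.rfl

/-- Unfolding of the fixed-block family. -/
example : MatchingBlockPsdBound ↔
    ∀ b : ℕ, 1 ≤ b → ∃ α : ℝ, 0 < α ∧ ∃ n₀ : ℕ, ∀ n : ℕ, n₀ ≤ n → Even n → ∀ m : ℕ,
      Literature.Combinatorics.Optimization.HasBlockPsdFactorization n b m → (2 : ℝ) ^ (α * n) ≤ m :=
  Iff.rfl

/-- The fixed-block family contains T-SOC. -/
example (h : MatchingBlockPsdBound) : MatchingSmallBlockPsdBound := h 2 (by norm_num)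

/-- Relation to ordinary psd rank (tree API, for orientation): an `(S²₊)^m`-lift is in particular a psd
lift of size `2m` (`HasBlockPsdFactorization.hasPsdFactorization_pmOddCutSlack`, `(S²₊)^m ⊆ S^{2m}_+`), so a
psd-rank lower bound `r` for the odd-cut slack matrix only gives `m ≥ r/2`; the content of T-SOC is the
exponential bound on the NUMBER of `2 × 2` blocks, for which no general psd-rank bound is used. -/
example {n m : ℕ} (h : HasBlockPsdFactorization n 2 m) :
    HasPsdFactorization (Literature.Barriers.PneNP.pmOddCutSlack n) (2 * m) :=
  h.hasPsdFactorization_pmOddCutSlack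

end Summit.PneNP.MatchingPsdRank

end
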